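import Literature.NumberTheory.Automorphic.Liu2021.Def411WeilCarriersAtLineClassTransportPU
import Summits.HodgeConjecture.CorCM.B01.Transposition.Item6OmegaChiSplitting
import Summits.HodgeConjecture.HodgeCM.Model.ArchSideTerm
import HarnessLib

/-!
# Crux `H413` — stub S4a `StubT3aLineTransportAt` (T3a-LT, the finite-adélic LINE TRANSPORT) AT THE PIN'S FRAME `e₁`

HC_CM is proved only modulo the printed citations until rung 0 closes.

F0P4-p06 (g0), S4a lead, 2026-08-30 (F0P4-plan (g2) 22:38:59Z ∕ 22:54:30Z; line `Cruxes/H413/Lines/F0_P4AdmissibleOccursInH1.lean` ED. 2).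
PROOF FILE (one theorem, no `def`, no `sorry`) for crux item `stmt-HodgeConjecture-24833`.

WHAT IS PROVED.  `lineTransportAt_e₁` — the body of the registered stub `StubT3aLineTransportAt` with its frame binder
`{n} (e : Fin 3 × Fin 1 ≃ Fin n)` specialised to the pin's frame `HodgeCM.Model.ArchSideTerm.e₁ = Equiv.prodUnique (Fin 3) (Fin 1)` — the ONLY
frame at which the line's composition consumes the stub (`stubT3aOfRallis_of … := hLT ⟨K F⟩ e₁ (frameD V) …`): for a CM field `L`, a real non-zero
diagonal frame `dV : Fin 3 → L`, a unitary Hecke character `θ` with the rank-one splitting condition, lines `a, a′ ∈ (L⁺)ˣ` with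
`locF L⁺ δ² a = locF L⁺ δ² a′` and `χ ∈ Chi`, the carriers `omegaAtLine … (OmegaChiSplitting.hsChiD L e₁ dV hdV hdV0 θ hθu hθs) a χ` and `… a′ χ` are
isomorphic `U(diag dV)(𝔸_{L⁺,f})`-equivariantly on the nose.  It IS the unconditional master ★
`Def411WeilCarriers.exists_omegaAtLine_equiv_rhoVAtLine_of_locF_eq` (road (F): local Witt witnesses with the unramified eigenvector property, the
local Weil intertwiners `M_{x_v}`, Flath gluing, Kronecker re-indexing, descent to the `χ`-coinvariants) at `N := 3`; the family
`OmegaChiSplitting.hsChiD L e₁ …` is `fun a ↦ isCompatible_chiSplittingLine L e₁ … (TW a) (isSymm_TW a) (isUnit_det_TW a) (JW a) (JW_eq a)` by `δ` (`sChiD`).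
The frame-general letter (`∀ e`) is this theorem composed with the `e`-reindex transport of `omegaAtLine` (F0P4-p04 (g0), in progress).

Sources: [Liu2021, Def. 4.11 (l. 2092–2096), Def. 4.12, App. D §D.1 Step 1 footnote (l. 5215), Steps 2–3]; [GelbartRogawski1991, §3.1 Prop. 3.1.1
p. 455, Remark p. 457]; [MoeglinVignerasWaldspurger1987, Chap. 3 I.1–I.3]; [Flath1979, §2 Example 2].
-/

set_option autoImplicit false

-- the mandated namespace has the single-problem summit's repeated segment (`HodgeConjecture.HodgeConjecture`), as in every `Cruxes/…` module of this sub-problem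
set_option linter.dupNamespace false

noncomputable section

namespace Summit.HodgeConjecture.HodgeConjecture.Cruxes.H413.LineTransport

open NumberField
open scoped Matrix
open Literature.NumberTheory.Automorphic Literature.NumberTheory.Automorphic.UnitaryGroup
open Literature.NumberTheory.Automorphic.Liu2021
open Literature.NumberTheory.Automorphic.Liu2021.Def411WeilCarriers (locF omegaAtLine rhoVAtLine Chi)
open Literature.NumberTheory.Automorphic.Liu2021.Def411WeilCarriersDoubling
open Literature.NumberTheory.GelbartRogawski1991 Literature.NumberTheory.GelbartRogawski1991.UnitaryDualPair
open Literature.NumberTheory.GelbartRogawski1991.GRConstruction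
open Literature.RepresentationTheory.HarrisKudlaSweet1996
open Literature.NumberTheory.GaloisRepresentations (HeckeCharacter)
open Summit.HodgeConjecture.CorCM Summit.HodgeConjecture.CorCM.Transposition
open HodgeCM.Model.ArchSideTerm (e₁)

set_option synthInstance.maxHeartbeats 400000 in
set_option maxHeartbeats 3200000 in
/-- **S4a AT THE PIN'S FRAME** (`StubT3aLineTransportAt` with `e := e₁ = Equiv.prodUnique (Fin 3) (Fin 1)`): for `L` CM, a real non-zero diagonal frame
`dV : Fin 3 → L`, a unitary splitting character `θ`, `a, a′ ∈ (L⁺)ˣ` with `locF L⁺ δ² a = locF L⁺ δ² a′` and `χ ∈ Chi`, there is a LINEAR EQUIVALENCE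
`Ψ : omegaAtLine … (hsChiD L e₁ …) a χ ≃ₗ[ℂ] omegaAtLine … (hsChiD L e₁ …) a′ χ` intertwining `rhoVAtLine … a χ` and `rhoVAtLine … a′ χ` — the unconditional
master ★ `Def411WeilCarriers.exists_omegaAtLine_equiv_rhoVAtLine_of_locF_eq` at `N := 3`.
[cite: Liu2021, Def. 4.11 (l. 2092–2096); App. D §D.1 Step 1 footnote (l. 5215), Steps 2–3 (l. 5217–5221)]
[cite: GelbartRogawski1991, §3.1 Prop. 3.1.1 p. 455 L1–3; Remark p. 457 L4–13] [cite: MoeglinVignerasWaldspurger1987, Chap. 3 I.1–I.3]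
[cite: Flath1979, §2 Example 2] -/
theorem lineTransportAt_e₁ (L : Summit.HodgeConjecture.CorCM.CMField) (dV : Fin 3 → L)
    (hdV : ∀ j, IsCMField.complexConj L (dV j) = dV j) (hdV0 : ∀ j, dV j ≠ 0)
    (θ : Literature.NumberTheory.GaloisRepresentations.HeckeCharacter L) (hθu : θ.IsUnitary)
    (hθs : Literature.RepresentationTheory.HarrisKudlaSweet1996.IsSplittingChar L 1 θ)
    (a a' : (↥(maximalRealSubfield L))ˣ) (χ : Def411WeilCarriers.Chi ↥(maximalRealSubfield L) L (IsCMField.complexConj L))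
    (h : locF ↥(maximalRealSubfield L) (imagUnitSq L) a = locF ↥(maximalRealSubfield L) (imagUnitSq L) a') :
    ∃ Ψ : Def411WeilCarriers.omegaAtLine ↥(maximalRealSubfield L) L (IsCMField.complexConj L) 3 e₁ (Matrix.diagonal dV)
          (complexConj_imagUnit L) (imagUnit_ne_zero L) (imagUnit_mul_self L) (realDiagonal_isSymm L dV hdV)
          (isUnit_det_realDiagonal L dV hdV hdV0) (realDiagonal_map L dV hdV).symm (OmegaChiSplitting.hsChiD L e₁ dV hdV hdV0 θ hθu hθs)
          a χ ≃ₗ[ℂ]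
        Def411WeilCarriers.omegaAtLine ↥(maximalRealSubfield L) L (IsCMField.complexConj L) 3 e₁ (Matrix.diagonal dV)
          (complexConj_imagUnit L) (imagUnit_ne_zero L) (imagUnit_mul_self L) (realDiagonal_isSymm L dV hdV)
          (isUnit_det_realDiagonal L dV hdV hdV0) (realDiagonal_map L dV hdV).symm (OmegaChiSplitting.hsChiD L e₁ dV hdV hdV0 θ hθu hθs)
          a' χ,
      ∀ (k : ↥(UnitaryGroup.finAdelic ↥(maximalRealSubfield L) L (IsCMField.complexConj L) 3 (Matrix.diagonal dV)))
        (x : Def411WeilCarriers.omegaAtLine ↥(maximalRealSubfield L) L (IsCMField.complexConj L) 3 e₁ (Matrix.diagonal dV)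
          (complexConj_imagUnit L) (imagUnit_ne_zero L) (imagUnit_mul_self L) (realDiagonal_isSymm L dV hdV)
          (isUnit_det_realDiagonal L dV hdV hdV0) (realDiagonal_map L dV hdV).symm (OmegaChiSplitting.hsChiD L e₁ dV hdV hdV0 θ hθu hθs)
          a χ),
        Ψ (Def411WeilCarriers.rhoVAtLine ↥(maximalRealSubfield L) L (IsCMField.complexConj L) 3 e₁ (Matrix.diagonal dV)
            (complexConj_imagUnit L) (imagUnit_ne_zero L) (imagUnit_mul_self L) (realDiagonal_isSymm L dV hdV)
            (isUnit_det_realDiagonal L dV hdV hdV0) (realDiagonal_map L dV hdV).symm (OmegaChiSplitting.hsChiD L e₁ dV hdV hdV0 θ hθu hθs)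
            a χ k x) =
          Def411WeilCarriers.rhoVAtLine ↥(maximalRealSubfield L) L (IsCMField.complexConj L) 3 e₁ (Matrix.diagonal dV)
            (complexConj_imagUnit L) (imagUnit_ne_zero L) (imagUnit_mul_self L) (realDiagonal_isSymm L dV hdV)
            (isUnit_det_realDiagonal L dV hdV hdV0) (realDiagonal_map L dV hdV).symm (OmegaChiSplitting.hsChiD L e₁ dV hdV hdV0 θ hθu hθs)
            a' χ k (Ψ x) :=
  Def411WeilCarriers.exists_omegaAtLine_equiv_rhoVAtLine_of_locF_eq L (by norm_num) dV hdV hdV0 θ hθu hθs χ a a' h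

end Summit.HodgeConjecture.HodgeConjecture.Cruxes.H413.LineTransport

end
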